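import Summits.CriticalPhenomena.PercolationContinuityZ3.Theorems.Transplant.SkelSignCustomersAll
import Summits.CriticalPhenomena.PercolationContinuityZ3.Theorems.Transplant.BoxProdZdAll
import HarnessLib

/-!
# `X □ ℤ^m` for EVERY `m ≥ 1` and every graph `X` with a one-dimensional reflectable skeleton: `θ(p_c) = 0` at every vertex — UNCONDITIONAL

builds on p205010 (kernel theorem, internal audit signed; external expert review pending) — `m = 1` through the multi-type D″ node (p3-g8's
`LineSkeletonNeg.prodInt_criticalContinuity_holds`), `m ≥ 2` through the PRODUCT node (`BoxProdZ2.bsConj4_boxProdZd_all`).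
Status sentence (coordinator 2026-08-20T04:30Z): "θ(p_c) = 0 on ℤ^d, all d ≥ 2 — kernel-verified (Lean 4/Mathlib, standard axioms); internal
adversarial audit SIGNED 2026-08-20 04:29Z; external expert review pending."
Lane `prim-bschramm-*`, seat `prim-bschramm-p2` (gen 10; PART C1b; memo `HOME/bschramm/P2-LATTICES.md` §30); helper file (`--supports stmt-CriticalPhenomena-4575 --as helper`).

THE POINT (packaging).  A `LineSkeletonNeg` makes `X` connected (`graph_connected`: every vertex lies in a strip around a base vertex, strips are connected)
and quasi-transitive (`isQuasiTransitive`: finitely many frame types), which is all the product node asks of the factor; so the films and walls of this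
seat's series (`TriStrip`, `DiagStrip`, `HexRibbon` strips, and every other `LineSkeletonNeg` graph: the honeycomb, kagome and triangular lattices, …) times
`ℤ^m` are settled for every `m ≥ 1` by ONE statement, `LineSkeletonNeg.prodZd_criticalContinuity`.
* `LineSkeletonNeg.graph_connected`, `LineSkeletonNeg.isQuasiTransitive`, **`LineSkeletonNeg.prodZd_criticalContinuity (hm : 1 ≤ m)`**.
[cite: BenjaminiSchramm1996, Conj. 4 / Question 3] [cite: KozmaNitzan2024, §1 p. 2 (approach 1)]
-/

noncomputable section

namespace Summit.CriticalPhenomena.PercolationContinuityZ3.Theorems.Transplant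

namespace LineSkeletonNeg

open MeasureTheory Literature.Probability.Percolation Literature.Probability.LatticeModels SimpleGraph
open Literature.Barriers.CriticalPhenomena (IsQuasiTransitive)
open scoped Classical

variable {V : Type} {X : SimpleGraph V} [X.LocallyFinite]

/-- **A graph with a `LineSkeletonNeg` is connected**: every vertex lies in a wide enough strip around the base vertex of its frame type, and strips at
base vertices are connected. [folklore] -/
theorem graph_connected (Ψ : LineSkeletonNeg X) (v : V) : X.Connected := by
  haveI : Nonempty V := ⟨v⟩
  refine Connected.mk fun a b => ?_
  obtain ⟨t, ht, -, -, -⟩ := Ψ.frame a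
  have key : ∀ w : V, X.Reachable w t := fun w => by
    refine Ψ.reachable_of_mem_strip ht (ℓ := (Ψ.ψ w - Ψ.ψ t).natAbs + 1) (by omega) ?_
    rw [mem_strip]
    push_cast
    omega
  exact (key a).trans (key b).symm

/-- **A graph with a `LineSkeletonNeg` is quasi-transitive** (finitely many frame types). [cite: BenjaminiSchramm1996, Question 3] -/
theorem isQuasiTransitive (Ψ : LineSkeletonNeg X) : IsQuasiTransitive X := by
  refine ⟨Ψ.types, fun v => ?_⟩
  obtain ⟨t, ht, α, hαt, -⟩ := Ψ.frame v
  exact ⟨α.symm, by rw [← hαt, RelIso.symm_apply_apply]; exact ht⟩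

/-- **THEOREM: `θ_{X □ ℤ^m}(v, p_c) = 0` for every `m ≥ 1`, every vertex, for every graph `X` with a one-dimensional reflectable skeleton** —
`m = 1`: the multi-type D″ node (p3-g8's `prodInt_criticalContinuity_holds`); `m ≥ 2`: the product node at the connected quasi-transitive factor `X`.
Builds on p205010 (kernel theorem, internal audit signed; external expert review pending). [cite: BenjaminiSchramm1996, Conj. 4 / Question 3] -/
theorem prodZd_criticalContinuity (Ψ : LineSkeletonNeg X) {m : ℕ} (hm : 1 ≤ m) [(X □ zdGraph m).LocallyFinite] (v : V × Site m) :
    theta (X □ zdGraph m) v (criticalProbIOf (X □ zdGraph m) v) = 0 := by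
  rcases Nat.lt_or_ge m 2 with h1 | h2
  · obtain rfl : m = 1 := by omega
    exact Ψ.prodInt_criticalContinuity_holds v
  · exact BoxProdZ2.bsConj4_boxProdZd_all X (Ψ.graph_connected v.1) Ψ.isQuasiTransitive h2 v

end LineSkeletonNeg

end Summit.CriticalPhenomena.PercolationContinuityZ3.Theorems.Transplant

end
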